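import Literature.NumberTheory.Transcendental.ZudilinPhiGrowth
import HarnessLib

/-!
# Primes `p` with `{n/p} ∈ [u, v)`: the density `∑_k (1/(k+u) − 1/(k+v)) = ψ(v) − ψ(u)`

Topic `Literature/NumberTheory/DiophantineApproximation`. Everything here is PROVED (prime number theorem
from the tree's `LFunctions.chebyshevTheta_isEquivalent` via `Zudilin2004.PhiCert.tendsto_theta_div`, whose
file treats the finitely many classes of Zudilin's `Φ_n`-certificate; here: all classes of one interval, general
`u, v`); no definitions, no named facts.

In the Rhin–Viola permutation group method (Rhin–Viola 1996, 2001, 2005; Viola–Zudilin 2018, §6.1) the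
arithmetic gain is the product `Δ_n = ∏ p` over the primes `p` (`p > √(Hn)`) whose fractional part
`ω = {n/p}` lies in a finite union `Ω` of intervals `[u, v) ⊂ (0, 1)`, and the asymptotics used is
"`lim (1/n) log Δ_n = ∫_Ω dψ(x)`, where `ψ(x)` is the logarithmic derivative of the Euler gamma-function"
(Viola–Zudilin 2018, §6.1, definition of `c₃`). For one interval, grouping the primes by `k = ⌊n/p⌋`
(`u ≤ {n/p} < v` with `⌊n/p⌋ = k` means `n/(k+v) < p ≤ n/(k+u)`), the sum `∑_{u ≤ {n/p} < v} log p` is the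
class sum `∑_{k ≥ 0} (θ(n/(k+u)) − θ(n/(k+v)))`, and the statement proved here is its asymptotics:

**Theorem** (`tendsto_sum_theta_class_div`, `tendsto_sum_log_prime_fract_div`). For `0 < u < v ≤ 1`,
`(1/n) ∑_{p prime, u ≤ {n/p} < v} log p = (1/n) ∑_{k < n} (θ(n/(k+u)) − θ(n/(k+v))) ⟶ ∑_{k ≥ 0} (1/(k+u) − 1/(k+v))`
(`= ψ(v) − ψ(u)`; we keep the series, Mathlib having no digamma function; the class-sum form is proved for
`0 < u < v ≤ u + 1`, the identification `sum_theta_class_eq_sum_log_prime` for `v ≤ 1`).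

Proof (the classical one): each class contributes `(1/(k+u) − 1/(k+v)) n + o(n)` by the prime number
theorem `θ(x) ∼ x` (the tree's `Zudilin2004.PhiCert.tendsto_theta_div`, from
`LFunctions.chebyshevTheta_isEquivalent`), and the classes `k ≥ K` contribute at most
`θ(n/(K+u)) ≤ log 4 · n/(K+u)` (Chebyshev), uniformly in `n` (`sum_Ico_theta_class_le`).

What is NOT here: the cut-off `p > √(Hn)` of the method (which changes the sum by `O(√n log n)`), finite
unions `Ω` (add the intervals), and the evaluation of the series by the digamma function.

## References

* G. Rhin, C. Viola, *The permutation group method for the dilogarithm*, Ann. Sc. Norm. Super. Pisa (5) 4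
  (2005) 389–437, §4 (the arithmetic of `Δ_n`).
* C. Viola, W. Zudilin, *Linear independence of dilogarithmic values*, J. reine angew. Math. 736 (2018),
  §6.1 (`Δ_n`, `Ω`, `c₃ = … − ∫_Ω dψ`). [ViolaZudilin2018]
-/

noncomputable section

namespace Literature.NumberTheory.DiophantineApproximation

namespace RhinViola

open _root_.Filter _root_.Topology Finset

/-! ### The prime number theorem on one class -/

/-- One class: `(θ(n/(k+u)) − θ(n/(k+v)))/n → 1/(k+u) − 1/(k+v)` (`u, v > 0`), from `θ(n/a)/n → 1/a`
(prime number theorem, the tree's `Zudilin2004.PhiCert.tendsto_theta_div`). [folklore] -/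
theorem tendsto_theta_class_div {u v : ℝ} (hu : 0 < u) (hv : 0 < v) (k : ℕ) :
    Tendsto (fun n : ℕ =>
        (Chebyshev.theta ((n : ℝ) / (k + u)) - Chebyshev.theta ((n : ℝ) / (k + v))) / n)
      atTop (𝓝 (1 / ((k : ℝ) + u) - 1 / ((k : ℝ) + v))) := by
  have h := (Literature.NumberTheory.Transcendental.Zudilin2004.PhiCert.tendsto_theta_div
      (show (0 : ℝ) < k + u by positivity)).sub
    (Literature.NumberTheory.Transcendental.Zudilin2004.PhiCert.tendsto_theta_div
      (show (0 : ℝ) < k + v by positivity))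
  exact h.congr fun n => by ring

/-! ### The tail classes, uniformly in `n` (Chebyshev) -/

/-- Each class difference is non-negative: `θ(n/(k+v)) ≤ θ(n/(k+u))` for `0 < u ≤ v`. [folklore] -/
theorem theta_class_nonneg {u v : ℝ} (hu : 0 < u) (huv : u ≤ v) (n k : ℕ) :
    0 ≤ Chebyshev.theta ((n : ℝ) / (k + u)) - Chebyshev.theta ((n : ℝ) / (k + v)) := by
  refine sub_nonneg.2 (Chebyshev.theta_mono ?_)
  exact div_le_div_of_nonneg_left (Nat.cast_nonneg n) (by positivity) (by linarith)

/-- **Tail bound**: for `0 < u ≤ v ≤ u + 1`, the classes `K ≤ k < L` contribute at most `θ(n/(K+u))`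
(they live in disjoint sub-intervals of `(0, n/(K+u)]`; telescoping). [folklore] -/
theorem sum_Ico_theta_class_le {u v : ℝ} (hu : 0 < u) (huv : u ≤ v) (hv1 : v ≤ u + 1) (n K L : ℕ) :
    ∑ k ∈ Ico K L, (Chebyshev.theta ((n : ℝ) / (k + u)) - Chebyshev.theta ((n : ℝ) / (k + v)))
      ≤ Chebyshev.theta ((n : ℝ) / (K + u)) := by
  have hv : 0 < v := hu.trans_le huv
  set a : ℕ → ℝ := fun k => Chebyshev.theta ((n : ℝ) / (k + u)) with ha
  have hterm : ∀ k : ℕ, Chebyshev.theta ((n : ℝ) / (k + u)) - Chebyshev.theta ((n : ℝ) / (k + v))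
      ≤ a k - a (k + 1) := by
    intro k
    have hmono : a (k + 1) ≤ Chebyshev.theta ((n : ℝ) / (k + v)) := by
      simp only [ha]
      refine Chebyshev.theta_mono (div_le_div_of_nonneg_left (Nat.cast_nonneg n) ?_ ?_)
      · positivity
      · push_cast; linarith
    have hak : a k = Chebyshev.theta ((n : ℝ) / (k + u)) := rfl
    linarith
  calc ∑ k ∈ Ico K L, (Chebyshev.theta ((n : ℝ) / (k + u)) - Chebyshev.theta ((n : ℝ) / (k + v)))
      ≤ ∑ k ∈ Ico K L, (a k - a (k + 1)) := sum_le_sum fun k _ => hterm k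
    _ = ∑ i ∈ range (L - K), (a (K + i) - a (K + (i + 1))) := by
        rw [sum_Ico_eq_sum_range]; simp only [add_assoc]
    _ = a (K + 0) - a (K + (L - K)) := sum_range_sub' (fun i => a (K + i)) (L - K)
    _ ≤ a (K + 0) := sub_le_self _ (Chebyshev.theta_nonneg _)
    _ = a K := by rw [add_zero]

/-- The tail bound with Chebyshev's `θ(x) ≤ x log 4`: classes `k ≥ K` contribute at most
`log 4 · n/(K+u)`. [folklore] -/
theorem sum_Ico_theta_class_le_mul {u v : ℝ} (hu : 0 < u) (huv : u ≤ v) (hv1 : v ≤ u + 1)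
    (n K L : ℕ) :
    ∑ k ∈ Ico K L, (Chebyshev.theta ((n : ℝ) / (k + u)) - Chebyshev.theta ((n : ℝ) / (k + v)))
      ≤ Real.log 4 * ((n : ℝ) / (K + u)) :=
  (sum_Ico_theta_class_le hu huv hv1 n K L).trans (Chebyshev.theta_le_log4_mul_x (by positivity))

/-! ### The density series -/

/-- The density series `∑_k (1/(k+u) − 1/(k+v))` has non-negative terms for `0 < u ≤ v`. [folklore] -/
theorem densityTerm_nonneg {u v : ℝ} (hu : 0 < u) (huv : u ≤ v) (k : ℕ) :
    0 ≤ 1 / ((k : ℝ) + u) - 1 / ((k : ℝ) + v) :=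
  sub_nonneg.2 (one_div_le_one_div_of_le (by positivity) (by linarith))

/-- The density series `∑_k (1/(k+u) − 1/(k+v))` converges for `0 < u ≤ v ≤ u + 1` (it is dominated by
the telescoping series `∑_k (1/(k+u) − 1/(k+1+u)) = 1/u`). [folklore] -/
theorem summable_densityTerm {u v : ℝ} (hu : 0 < u) (huv : u ≤ v) (hv1 : v ≤ u + 1) :
    Summable fun k : ℕ => 1 / ((k : ℝ) + u) - 1 / ((k : ℝ) + v) := by
  have hv : 0 < v := hu.trans_le huv
  set t : ℕ → ℝ := fun k => 1 / ((k : ℝ) + u) - 1 / ((k : ℝ) + 1 + u) with ht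
  have ht0 : ∀ k, 0 ≤ t k := fun k =>
    sub_nonneg.2 (one_div_le_one_div_of_le (by positivity) (by linarith))
  have htsum : ∀ m : ℕ, ∑ i ∈ range m, t i ≤ 1 / u := by
    intro m
    have htel : ∑ i ∈ range m, t i = 1 / (((0 : ℕ) : ℝ) + u) - 1 / (((m : ℕ) : ℝ) + u) := by
      rw [← sum_range_sub' (fun i : ℕ => 1 / ((i : ℝ) + u)) m]
      refine sum_congr rfl fun i _ => ?_
      simp only [ht]
      push_cast
      ring
    rw [htel]
    simp only [Nat.cast_zero, zero_add]
    have : 0 ≤ 1 / ((m : ℝ) + u) := by positivity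
    linarith
  have hts : Summable t := summable_of_sum_range_le ht0 htsum
  refine Summable.of_nonneg_of_le (densityTerm_nonneg hu huv) (fun k => ?_) hts
  simp only [ht]
  have : 1 / ((k : ℝ) + 1 + u) ≤ 1 / ((k : ℝ) + v) :=
    one_div_le_one_div_of_le (by positivity) (by linarith)
  linarith

/-! ### The main asymptotic: sum over all classes -/

/-- **Asymptotics of the class sum**: for `0 < u < v ≤ u + 1`,
`(1/n) ∑_{k < n} (θ(n/(k+u)) − θ(n/(k+v))) → ∑_k (1/(k+u) − 1/(k+v))` (prime number theorem on each of the
first `K` classes, Chebyshev on the tail, `K → ∞`). This is "`lim (1/n) log Δ_n = ∫_Ω dψ`" of the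
Rhin–Viola method for one class interval `Ω = [u, v)`, in the form of a sum over the classes `k = ⌊n/p⌋`.
[folklore] -/
theorem tendsto_sum_theta_class_div {u v : ℝ} (hu : 0 < u) (huv : u < v) (hv1 : v ≤ u + 1) :
    Tendsto (fun n : ℕ => (∑ k ∈ range n,
        (Chebyshev.theta ((n : ℝ) / (k + u)) - Chebyshev.theta ((n : ℝ) / (k + v)))) / n)
      atTop (𝓝 (∑' k : ℕ, (1 / ((k : ℝ) + u) - 1 / ((k : ℝ) + v)))) := by
  have hv : 0 < v := hu.trans huv
  set s : ℕ → ℝ := fun k => 1 / ((k : ℝ) + u) - 1 / ((k : ℝ) + v) with hs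
  set D : ℕ → ℕ → ℝ := fun k n =>
    Chebyshev.theta ((n : ℝ) / (k + u)) - Chebyshev.theta ((n : ℝ) / (k + v)) with hD
  set S := ∑' k : ℕ, s k with hS
  have hsum : Summable s := summable_densityTerm hu huv.le hv1
  rw [Metric.tendsto_atTop]
  intro ε hε
  have hε3 : 0 < ε / 3 := by positivity
  -- `K₁`: partial sums of the density series within `ε/3`
  obtain ⟨K₁, hK₁⟩ := Metric.tendsto_atTop.1 hsum.hasSum.tendsto_sum_nat (ε / 3) hε3
  -- `K₂`: Chebyshev tail `log 4/(K+u) < ε/3`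
  obtain ⟨K₂, hK₂⟩ := exists_nat_gt (Real.log 4 / (ε / 3))
  set K := max K₁ K₂ with hK
  have hKtail : Real.log 4 / ((K : ℝ) + u) < ε / 3 := by
    have hK2 : (K₂ : ℝ) ≤ K := by exact_mod_cast le_max_right K₁ K₂
    have hKu : (0 : ℝ) < (K : ℝ) + u := by positivity
    rw [div_lt_iff₀ hKu]
    rw [div_lt_iff₀ hε3] at hK₂
    nlinarith
  have hSK : dist (∑ k ∈ range K, s k) S < ε / 3 := hK₁ K (le_max_left _ _)
  -- `N₁`: the first `K` classes within `ε/3` (prime number theorem)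
  have hfin : Tendsto (fun n : ℕ => ∑ k ∈ range K, D k n / n) atTop (𝓝 (∑ k ∈ range K, s k)) :=
    tendsto_finsetSum _ fun k _ => tendsto_theta_class_div hu hv k
  obtain ⟨N₁, hN₁⟩ := Metric.tendsto_atTop.1 hfin (ε / 3) hε3
  refine ⟨max N₁ (max K 1), fun n hn => ?_⟩
  have hnN : N₁ ≤ n := le_trans (le_max_left _ _) hn
  have hnK : K ≤ n := le_trans ((le_max_left _ _).trans (le_max_right _ _)) hn
  have hn1 : 1 ≤ n := le_trans ((le_max_right _ _).trans (le_max_right _ _)) hn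
  have hn0 : (0 : ℝ) < n := by exact_mod_cast hn1
  -- split the classes at `K`
  have hsplit : ∑ k ∈ range n, D k n = ∑ k ∈ range K, D k n + ∑ k ∈ Ico K n, D k n :=
    (sum_range_add_sum_Ico _ hnK).symm
  have htail0 : 0 ≤ ∑ k ∈ Ico K n, D k n :=
    sum_nonneg fun k _ => theta_class_nonneg hu huv.le n k
  have htail : (∑ k ∈ Ico K n, D k n) / n < ε / 3 := by
    have h1 := sum_Ico_theta_class_le_mul hu huv.le hv1 n K n
    calc (∑ k ∈ Ico K n, D k n) / n ≤ Real.log 4 * ((n : ℝ) / (K + u)) / n :=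
          div_le_div_of_nonneg_right h1 hn0.le
      _ = Real.log 4 / ((K : ℝ) + u) := by field_simp
      _ < ε / 3 := hKtail
  have hfinN : dist (∑ k ∈ range K, D k n / n) (∑ k ∈ range K, s k) < ε / 3 := hN₁ n hnN
  rw [Real.dist_eq] at hSK hfinN ⊢
  have hdecomp : (∑ k ∈ range n, D k n) / n - S =
      (∑ k ∈ range K, D k n / n - ∑ k ∈ range K, s k) + (∑ k ∈ Ico K n, D k n) / n +
        (∑ k ∈ range K, s k - S) := by
    rw [hsplit, add_div, sum_div]
    ring
  rw [hdecomp]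
  calc |(∑ k ∈ range K, D k n / n - ∑ k ∈ range K, s k) + (∑ k ∈ Ico K n, D k n) / n +
          (∑ k ∈ range K, s k - S)|
      ≤ |∑ k ∈ range K, D k n / n - ∑ k ∈ range K, s k| + |(∑ k ∈ Ico K n, D k n) / n| +
          |∑ k ∈ range K, s k - S| := abs_add_three _ _ _
    _ < ε / 3 + ε / 3 + ε / 3 := by
        have h2 : |(∑ k ∈ Ico K n, D k n) / n| < ε / 3 := by
          rw [abs_of_nonneg (div_nonneg htail0 hn0.le)]; exact htail
        linarith [hfinN, h2, hSK]
    _ = ε := by ring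

/-! ### Identification with the sum over primes `p` with `u ≤ {n/p} < v` -/

/-- **The class sum is the sum over primes.** For `0 < u < v ≤ 1`, `n : ℕ` and any `N ≥ n/u`:
`∑_{k < n} (θ(n/(k+u)) − θ(n/(k+v))) = ∑_{p ≤ N prime, u ≤ {n/p} < v} log p` — a prime `p` has
`u ≤ {n/p} < v` with `⌊n/p⌋ = k` exactly when `n/(k+v) < p ≤ n/(k+u)`, and all such `p` satisfy
`p ≤ n/u ≤ N` and `k ≤ n/2 < n`. [folklore] -/
theorem sum_theta_class_eq_sum_log_prime {u v : ℝ} (hu : 0 < u) (huv : u < v) (hv : v ≤ 1) (n N : ℕ)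
    (hN : (n : ℝ) / u ≤ N) :
    ∑ k ∈ range n, (Chebyshev.theta ((n : ℝ) / (k + u)) - Chebyshev.theta ((n : ℝ) / (k + v)))
      = ∑ p ∈ (range (N + 1)).filter
          (fun p : ℕ => p.Prime ∧ u ≤ Int.fract ((n : ℝ) / p) ∧ Int.fract ((n : ℝ) / p) < v),
        Real.log p := by
  have hv0 : 0 < v := hu.trans huv
  -- the classes as finite sets of primes
  set C : ℕ → Finset ℕ := fun k =>
    (Ioc ⌊(n : ℝ) / (k + v)⌋₊ ⌊(n : ℝ) / (k + u)⌋₊).filter Nat.Prime with hC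
  have hclass : ∀ k : ℕ, Chebyshev.theta ((n : ℝ) / (k + u)) - Chebyshev.theta ((n : ℝ) / (k + v))
      = ∑ p ∈ C k, Real.log p := fun k =>
    Literature.NumberTheory.Transcendental.Zudilin2004.PhiCert.theta_sub_theta
      (div_le_div_of_nonneg_left (Nat.cast_nonneg n) (by positivity) (by linarith))
  -- membership in a class, in real terms
  have hmemC : ∀ k p : ℕ, p ∈ C k ↔
      p.Prime ∧ (n : ℝ) / (k + v) < p ∧ (p : ℝ) ≤ (n : ℝ) / (k + u) := by
    intro k p
    simp only [hC, mem_filter, mem_Ioc]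
    rw [Nat.floor_lt (by positivity), Nat.le_floor_iff (by positivity)]
    tauto
  -- the classes are pairwise disjoint (`v ≤ 1 ≤ 1 + u`)
  have key : ∀ k₁ k₂ : ℕ, k₁ < k₂ → Disjoint (C k₁) (C k₂) := by
    intro k₁ k₂ hlt
    refine Finset.disjoint_left.2 fun p hp1 hp2 => ?_
    obtain ⟨hp, h1, -⟩ := (hmemC k₁ p).1 hp1
    obtain ⟨-, -, h2⟩ := (hmemC k₂ p).1 hp2
    have hk : (k₁ : ℝ) + 1 ≤ k₂ := by exact_mod_cast hlt
    have hle : (n : ℝ) / (k₂ + u) ≤ (n : ℝ) / (k₁ + v) :=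
      div_le_div_of_nonneg_left (Nat.cast_nonneg n) (by positivity) (by linarith)
    linarith
  have hdisj : Set.PairwiseDisjoint (↑(range n) : Set ℕ) C := by
    intro k₁ _ k₂ _ hne
    rcases lt_or_gt_of_ne hne with hlt | hlt
    · exact key _ _ hlt
    · exact (key _ _ hlt).symm
  rw [sum_congr rfl fun k _ => hclass k, ← sum_biUnion hdisj]
  -- the union of the classes `k < n` is the set of primes `p ≤ N` with `u ≤ {n/p} < v`
  congr 1
  ext p
  simp only [mem_biUnion, mem_range, mem_filter]
  constructor
  · rintro ⟨k, hk, hpC⟩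
    obtain ⟨hp, h1, h2⟩ := (hmemC k p).1 hpC
    have hp0 : (0 : ℝ) < p := by exact_mod_cast hp.pos
    have hku : (0 : ℝ) < k + u := by positivity
    have hkv : (0 : ℝ) < k + v := by positivity
    -- `k + u ≤ n/p < k + v`, so `⌊n/p⌋ = k` and `{n/p} = n/p - k ∈ [u, v)`
    have hlow : (k : ℝ) + u ≤ (n : ℝ) / p := by
      rw [le_div_iff₀ hp0]; rw [le_div_iff₀ hku] at h2; linarith
    have hupp : (n : ℝ) / p < k + v := by
      rw [div_lt_iff₀ hp0]; rw [div_lt_iff₀ hkv] at h1; linarith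
    have hfloor : ⌊(n : ℝ) / p⌋ = (k : ℤ) := by
      rw [Int.floor_eq_iff]; push_cast; constructor <;> linarith
    have hfract : Int.fract ((n : ℝ) / p) = (n : ℝ) / p - k := by
      rw [← Int.self_sub_floor, hfloor]; push_cast; ring
    refine ⟨?_, hp, ?_, ?_⟩
    · -- `p ≤ n/(k+u) ≤ n/u ≤ N`
      have h3 : (n : ℝ) / (k + u) ≤ (n : ℝ) / u :=
        div_le_div_of_nonneg_left (Nat.cast_nonneg n) hu (by linarith [(Nat.cast_nonneg k : (0:ℝ) ≤ k)])
      have h4 : (p : ℝ) ≤ N := h2.trans (h3.trans hN)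
      have h5 : p ≤ N := by exact_mod_cast h4
      omega
    · rw [hfract]; linarith
    · rw [hfract]; linarith
  · rintro ⟨-, hp, hfu, hfv⟩
    have hp0 : (0 : ℝ) < p := by exact_mod_cast hp.pos
    set x : ℝ := (n : ℝ) / p with hx
    have hx0 : 0 ≤ x := by positivity
    -- `k = ⌊n/p⌋`
    set k : ℕ := ⌊x⌋₊ with hk
    have hk1 : (k : ℝ) ≤ x := Nat.floor_le hx0
    have hk2 : x < k + 1 := Nat.lt_floor_add_one x
    have hfloor : ⌊x⌋ = (k : ℤ) := by
      rw [Int.floor_eq_iff]; push_cast; exact ⟨hk1, hk2⟩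
    have hfract : Int.fract x = x - k := by
      rw [← Int.self_sub_floor, hfloor]; push_cast; ring
    rw [hfract] at hfu hfv
    have hku : (0 : ℝ) < k + u := by positivity
    have hkv : (0 : ℝ) < k + v := by positivity
    refine ⟨k, ?_, (hmemC k p).2 ⟨hp, ?_, ?_⟩⟩
    · -- `k ≤ n/p ≤ n/2 < n` (`n ≠ 0` since `{0} = 0 < u`)
      have hn : n ≠ 0 := by
        rintro rfl
        simp [hx] at hfu
        linarith
      have hp2 : (2 : ℝ) ≤ p := by exact_mod_cast hp.two_le
      have hxle : x ≤ (n : ℝ) / 2 := div_le_div_of_nonneg_left (Nat.cast_nonneg n) two_pos hp2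
      have hnpos : (0 : ℝ) < n := by exact_mod_cast Nat.pos_of_ne_zero hn
      have : (k : ℝ) < n := by linarith
      exact_mod_cast this
    · rw [div_lt_iff₀ hkv]
      have : x < k + v := by linarith
      rw [hx, div_lt_iff₀ hp0] at this
      linarith
    · rw [le_div_iff₀ hku]
      have : (k : ℝ) + u ≤ x := by linarith
      rw [hx, le_div_iff₀ hp0] at this
      linarith

/-- **Density of the primes `p` with `u ≤ {n/p} < v`** (`0 < u < v ≤ 1`): for any bounds `N_n ≥ n/u`
(beyond `n/u` no prime qualifies), `(1/n) ∑_{p ≤ N_n prime, u ≤ {n/p} < v} log p → ∑_k (1/(k+u) − 1/(k+v))`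
(`= ψ(v) − ψ(u) = ∫_{[u,v)} dψ`). This is the one-interval case of "`lim (1/n) log Δ_n = ∫_Ω dψ(x)`"
(Viola–Zudilin 2018, §6.1; Rhin–Viola), up to the cut-off `p > √(Hn)` which removes `O(√n)`.
[cite: ViolaZudilin2018, §6.1 (definition of c₃)] -/
theorem tendsto_sum_log_prime_fract_div {u v : ℝ} (hu : 0 < u) (huv : u < v) (hv : v ≤ 1) (N : ℕ → ℕ)
    (hN : ∀ n : ℕ, (n : ℝ) / u ≤ N n) :
    Tendsto (fun n : ℕ => (∑ p ∈ (range (N n + 1)).filter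
          (fun p : ℕ => p.Prime ∧ u ≤ Int.fract ((n : ℝ) / p) ∧ Int.fract ((n : ℝ) / p) < v),
        Real.log p) / n)
      atTop (𝓝 (∑' k : ℕ, (1 / ((k : ℝ) + u) - 1 / ((k : ℝ) + v)))) := by
  refine (tendsto_sum_theta_class_div hu huv (by linarith)).congr fun n => ?_
  rw [sum_theta_class_eq_sum_log_prime hu huv hv n (N n) (hN n)]

end RhinViola

end Literature.NumberTheory.DiophantineApproximation

end
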